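/-
Copyright (c) 2026 the pub-hodgecm-mathlib formalisation cell (harness21).  Prover seat hodgecm-mathlib-K2E3-p12 (g8), Track B ∕ K2-LIT, h413 = `stmt-HodgeConjecture-24833`,
line `K2_E1_TraceFormulaBeta`, 5Res ROADCARD (154)∕(277)(B3): the two analytic letters of the section pairing on a vertical line — a UNIFORM BOUND and CONTINUITY in `t` of
`t ↦ (ν𝓕)⁻¹∫_{K_U} φ(k)·conj I_ψ(w(t), k) dμ_K` for any continuous path `w` with `Re w(t) = σ₀ > 1` (`w(t) = σ₀ ± it`: the `B_z`∕`B_{z̄}` of ★ p860772∕★ p861029) — inputs of K2E4-p10's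
(KA) FILE 2 via ★ `K2E1MellinTestFunctionDensityLine.eq_of_forall_integral_mellin_mul_conj_mellin_mul_eq`.
-/
import Summits.HodgeConjecture.HodgeConjecture.Theorems.K2E1ChiPseudoEisensteinSelfDualCMTwo     -- ★ H-c p860715 (this seat): `continuous_integral_flatSectionU_weylLongU_vertical_cm_two`; ★ H-a §1 uniform Godement bound
import HarnessLib

/-!
# (277)(B3) letters — `K2E1ChiSectionPairingLineRegularityCMTwo`: `t ↦ (ν𝓕)⁻¹∫_{K_U} φ·conj I_ψ(w(t),·) dμ_K` IS BOUNDED AND CONTINUOUS on any vertical path `Re w(t) = σ₀ > 1`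

Track B ∕ K2-LIT, crux h413 = `stmt-HodgeConjecture-24833`, route of record `HCCMUnconditional`; cell `hodgecm-mathlib`, squad K2, ENGINE E1.  THEOREMS ONLY (no `def`, no `instance`,
no `notation`, no named-fact hypothesis, no `sorry`); lane `--supports stmt-HodgeConjecture-24833 --as helper` (count-neutral).
THE MATHEMATICS ([MoeglinWaldspurger1995, II.1.5, II.2.1]).  For continuous bounded `φ, ψ` and `Re w = σ₀ > 1`: `|I_ψ(w,k)| ≤ C_ψ·c₀` uniformly in `k ∈ K_U` (★ H-a §1, `c₀ = ∫H(w₀v)^{σ₀}dν`),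
so `|(ν𝓕)⁻¹∫_{K_U} φ·conj I_ψ(w,·)| ≤ (ν𝓕)⁻¹·C_φ·C_ψ·c₀·μ_K(K_U)` (§1); and `t ↦ I_ψ(σ₀+iy(t),k)` is continuous for each `k` (★ H-c §1, `y` continuous), so by dominated convergence on the
finite measure `μ_K` (Mathlib `continuous_of_dominated`; measurability by the parametric-integral tower) `t ↦ (ν𝓕)⁻¹∫_{K_U} φ·conj I_ψ(σ₀+iy(t),·) dμ_K` is continuous (§2).  With `y(t) = −t`
(`w = z̄`) this is `B_z(φ,ψ)` of ★ p860772; with `y(t) = t` it is the `B_{z̄}`-type term of ★ p861029.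
* §1 **`norm_sectionPairing_line_le_cm_two`**.  * §2 **`continuous_sectionPairing_line_cm_two`**.
HONEST LABEL: HC_CM is proved only modulo the 7 printed citations (2 remaining named inputs: hLiu418 = `stmt-HodgeConjecture-24832`, h413 = `stmt-HodgeConjecture-24833`) until rung 0
closes; this file asserts no named fact, closes no socket; count-neutral; letter-free.

## References
* [MoeglinWaldspurger1995] C. Mœglin, J.-L. Waldspurger, *Spectral decomposition and Eisenstein series* (1995), II.1.5, II.2.1.
-/

set_option autoImplicit false
set_option linter.dupNamespace false  -- the mandated namespace repeats the summit's segment (`HodgeConjecture.HodgeConjecture`)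

noncomputable section

open MeasureTheory Measure Set Filter Topology Complex NumberField IsDedekindDomain MulAction
open scoped Real NNReal ENNReal ComplexConjugate Pointwise
open Literature.MeasureTheory.Group Literature.NumberTheory
open Literature.NumberTheory.Automorphic Literature.NumberTheory.Automorphic.UnitaryGroup AdelicGroupData
open Summit.HodgeConjecture.HodgeConjecture.Cruxes.H413.K2E1BorelEisensteinU
open Summit.HodgeConjecture.HodgeConjecture.Cruxes.H413.K2E1ChiPseudoEisensteinIdeleSplitCMTwo (norm_integral_flatSectionU_weylLongU_maximalCompact_le_cm_two)
open Summit.HodgeConjecture.HodgeConjecture.Cruxes.H413.K2E1ChiPseudoEisensteinSelfDualCMTwo (continuous_integral_flatSectionU_weylLongU_vertical_cm_two)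
open Summit.HodgeConjecture.HodgeConjecture.Cruxes.H413.K2E1SphericalIntertwiningMellinCMTwo (sigmaFinite_haar_adelicUnipotent_cm_two)

namespace Summit.HodgeConjecture.HodgeConjecture.Cruxes.H413.K2E1ChiSectionPairingLineRegularityCMTwo

variable (L : Type) [Field L] [NumberField L] [IsCMField L]
variable [MeasurableSpace (quasiSplit (↥(maximalRealSubfield L)) L (IsCMField.complexConj L) 2).Adelic] [BorelSpace (quasiSplit (↥(maximalRealSubfield L)) L (IsCMField.complexConj L) 2).Adelic]

/-! ## §1 The uniform bound on the line -/

/-- **`‖(ν𝓕)⁻¹∫_{K_U} φ·conj I_ψ(σ₀+iy,·) dμ_K‖ ≤ |(ν𝓕)⁻¹|·(C_φ·(C_ψ·c₀))·μ_K(K_U)`** for all real `y` (`σ₀ > 1`, `‖φ‖ ≤ C_φ`, `‖ψ‖ ≤ C_ψ`, `c₀ = ∫_{N(𝔸)}H(w₀v)^{σ₀}dν`; uniform Godement bound ★ H-a §1).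
[cite: MoeglinWaldspurger1995, II.1.5] -/
theorem norm_sectionPairing_line_le_cm_two (ν : Measure ↥(adelicUnipotent (↥(maximalRealSubfield L)) L (IsCMField.complexConj L) 2)) [ν.IsHaarMeasure] {𝓕 : Set ↥(adelicUnipotent (↥(maximalRealSubfield L)) L (IsCMField.complexConj L) 2)}
    (h𝓕N : IsFundamentalDomain ↥(rationalUnipotent (↥(maximalRealSubfield L)) L (IsCMField.complexConj L) 2) 𝓕 ν) (h𝓕c : IsCompact (closure 𝓕)) (μK : Measure ((standardMaximalCompactGL 2 L).comap (adelicVal (↥(maximalRealSubfield L)) L (IsCMField.complexConj L) 2 ((StdForm.antidiagonal 2).over L)) : Subgroup (quasiSplit (↥(maximalRealSubfield L)) L (IsCMField.complexConj L) 2).Adelic)) [IsFiniteMeasure μK]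
    {φ ψ : (quasiSplit (↥(maximalRealSubfield L)) L (IsCMField.complexConj L) 2).Adelic → ℂ} {Cφ : ℝ} (hφC : ∀ x, ‖φ x‖ ≤ Cφ) {Cψ : ℝ} (hψC : ∀ x, ‖ψ x‖ ≤ Cψ) {σ₀ : ℝ} (hσ₀ : 1 < σ₀) (y : ℝ) :
    ‖(((((ν 𝓕).toReal⁻¹ : ℝ))) : ℂ) * ∫ k : ((standardMaximalCompactGL 2 L).comap (adelicVal (↥(maximalRealSubfield L)) L (IsCMField.complexConj L) 2 ((StdForm.antidiagonal 2).over L)) : Subgroup (quasiSplit (↥(maximalRealSubfield L)) L (IsCMField.complexConj L) 2).Adelic), φ (k : (quasiSplit (↥(maximalRealSubfield L)) L (IsCMField.complexConj L) 2).Adelic) * conj (∫ v : ↥(adelicUnipotent (↥(maximalRealSubfield L)) L (IsCMField.complexConj L) 2), flatSectionU ψ ((σ₀ : ℂ) + y * I) (((quasiSplit (↥(maximalRealSubfield L)) L (IsCMField.complexConj L) 2).toAdelic (weylLongU ((IsCMField.complexConj L : L ≃ₐ[↥(maximalRealSubfield L)] L) : L →+* L) (rfl : (StdForm.antidiagonal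 2).over L = (StdForm.antidiagonal 2).over L))) * ((v : (quasiSplit (↥(maximalRealSubfield L)) L (IsCMField.complexConj L) 2).Adelic) * (k : (quasiSplit (↥(maximalRealSubfield L)) L (IsCMField.complexConj L) 2).Adelic))) ∂ν) ∂μK‖ ≤ |((ν 𝓕).toReal⁻¹ : ℝ)| * ((Cφ * (Cψ * (∫ v : ↥(adelicUnipotent (↥(maximalRealSubfield L)) L (IsCMField.complexConj L) 2), (borelHeight (((quasiSplit (↥(maximalRealSubfield L)) L (IsCMField.complexConj L) 2).toAdelic (weylLongU ((IsCMField.complexConj L : L ≃ₐ[↥(maximalRealSubfield L)] L) : L →+* L) (rfl : (StdForm.antidiagonal 2).over L = (StdForm.antidiagonal 2).over L))) * (v : (quasiSplit (↥(maximalRealSubfield L)) L (IsCMField.complexConj L) 2).Adelic)) : ℝ) ^ σ₀ ∂ν))) * μK.real Set.univ) := by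
  have hCφ : 0 ≤ Cφ := (norm_nonneg _).trans (hφC 1)
  have hIb : ∀ k : ((standardMaximalCompactGL 2 L).comap (adelicVal (↥(maximalRealSubfield L)) L (IsCMField.complexConj L) 2 ((StdForm.antidiagonal 2).over L)) : Subgroup (quasiSplit (↥(maximalRealSubfield L)) L (IsCMField.complexConj L) 2).Adelic), ‖∫ v : ↥(adelicUnipotent (↥(maximalRealSubfield L)) L (IsCMField.complexConj L) 2), flatSectionU ψ ((σ₀ : ℂ) + y * I) (((quasiSplit (↥(maximalRealSubfield L)) L (IsCMField.complexConj L) 2).toAdelic (weylLongU ((IsCMField.complexConj L : L ≃ₐ[↥(maximalRealSubfield L)] L) : L →+* L) (rfl : (StdForm.antidiagonal 2).over L = (StdForm.antidiagonal 2).over L))) * ((v : (quasiSplit (↥(maximalRealSubfield L)) L (IsCMField.complexConj L) 2).Adelic) * (k : (quasiSplit (↥(maximalRealSubfield L)) L (IsCMField.complexConj L) 2).Adelic))) ∂ν‖ ≤ Cψ * (∫ v : ↥(adelicUnipotent (↥(maximalRealSubfield L)) L (IsCMField.complexConj L) 2), (borelHeight (((quasiSplit (↥(maximalRealSubfield L))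 L (IsCMField.complexConj L) 2).toAdelic (weylLongU ((IsCMField.complexConj L : L ≃ₐ[↥(maximalRealSubfield L)] L) : L →+* L) (rfl : (StdForm.antidiagonal 2).over L = (StdForm.antidiagonal 2).over L))) * (v : (quasiSplit (↥(maximalRealSubfield L)) L (IsCMField.complexConj L) 2).Adelic)) : ℝ) ^ σ₀ ∂ν) := fun k => by
    have h := norm_integral_flatSectionU_weylLongU_maximalCompact_le_cm_two L ν h𝓕N h𝓕c hψC (z := ((σ₀ : ℂ) + y * I)) (by simpa using hσ₀) k
    simpa using h
  rw [norm_mul, Complex.norm_real, Real.norm_eq_abs]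
  refine mul_le_mul_of_nonneg_left (norm_integral_le_of_norm_le_const (ae_of_all _ fun k => ?_)) (abs_nonneg _)
  rw [norm_mul, Complex.norm_conj]
  exact mul_le_mul (hφC _) (hIb k) (norm_nonneg _) hCφ

/-! ## §2 Continuity along the line -/

/-- **`t ↦ (ν𝓕)⁻¹∫_{K_U} φ·conj I_ψ(σ₀ + i·y(t), ·) dμ_K` IS CONTINUOUS** for any continuous `y : ℝ → ℝ` (`y = id`: `w = z`; `y = −id`: `w = z̄`, the `B_z` of ★ VectorGram), `φ, ψ` continuous bounded,
`σ₀ > 1` — dominated convergence on the finite `μ_K` with the constant majorant `C_φ·C_ψ·c₀` (§1), pointwise continuity ★ H-c §1, measurability by the parametric-integral tower.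
[cite: MoeglinWaldspurger1995, II.1.5, II.2.1] -/
theorem continuous_sectionPairing_line_cm_two (ν : Measure ↥(adelicUnipotent (↥(maximalRealSubfield L)) L (IsCMField.complexConj L) 2)) [ν.IsHaarMeasure] {𝓕 : Set ↥(adelicUnipotent (↥(maximalRealSubfield L)) L (IsCMField.complexConj L) 2)}
    (h𝓕N : IsFundamentalDomain ↥(rationalUnipotent (↥(maximalRealSubfield L)) L (IsCMField.complexConj L) 2) 𝓕 ν) (h𝓕c : IsCompact (closure 𝓕)) (μK : Measure ((standardMaximalCompactGL 2 L).comap (adelicVal (↥(maximalRealSubfield L)) L (IsCMField.complexConj L) 2 ((StdForm.antidiagonal 2).over L)) : Subgroup (quasiSplit (↥(maximalRealSubfield L)) L (IsCMField.complexConj L) 2).Adelic)) [IsFiniteMeasure μK]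
    {φ ψ : (quasiSplit (↥(maximalRealSubfield L)) L (IsCMField.complexConj L) 2).Adelic → ℂ} (hφc : Continuous φ) {Cφ : ℝ} (hφC : ∀ x, ‖φ x‖ ≤ Cφ) (hψc : Continuous ψ) {Cψ : ℝ} (hψC : ∀ x, ‖ψ x‖ ≤ Cψ) {σ₀ : ℝ} (hσ₀ : 1 < σ₀)
    {y : ℝ → ℝ} (hy : Continuous y) :
    Continuous fun t : ℝ => (((((ν 𝓕).toReal⁻¹ : ℝ))) : ℂ) * ∫ k : ((standardMaximalCompactGL 2 L).comap (adelicVal (↥(maximalRealSubfield L)) L (IsCMField.complexConj L) 2 ((StdForm.antidiagonal 2).over L)) : Subgroup (quasiSplit (↥(maximalRealSubfield L)) L (IsCMField.complexConj L) 2).Adelic), φ (k : (quasiSplit (↥(maximalRealSubfield L)) L (IsCMField.complexConj L) 2).Adelic) * conj (∫ v : ↥(adelicUnipotent (↥(maximalRealSubfield L)) L (IsCMField.complexConj L) 2), flatSectionU ψ ((σ₀ : ℂ) + (y t) * I) (((quasiSplit (↥(maximalRealSubfield L)) L (IsCMField.complexConj L) 2).toAdelic (weylLongU ((IsCMField.complexConj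 L : L ≃ₐ[↥(maximalRealSubfield L)] L) : L →+* L) (rfl : (StdForm.antidiagonal 2).over L = (StdForm.antidiagonal 2).over L))) * ((v : (quasiSplit (↥(maximalRealSubfield L)) L (IsCMField.complexConj L) 2).Adelic) * (k : (quasiSplit (↥(maximalRealSubfield L)) L (IsCMField.complexConj L) 2).Adelic))) ∂ν) ∂μK := by
  haveI := t2Space_adeleRing_of_numberField L
  haveI := locallyCompactSpace_adeleRing' L
  haveI := secondCountableTopology_adeleRing L
  haveI : SecondCountableTopology (quasiSplit (↥(maximalRealSubfield L)) L (IsCMField.complexConj L) 2).Adelic := inferInstanceAs (SecondCountableTopology (adelic (↥(maximalRealSubfield L)) L (IsCMField.complexConj L) 2 ((StdForm.antidiagonal 2).over L)))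
  haveI := sigmaFinite_haar_adelicUnipotent_cm_two L ν
  have hCφ : 0 ≤ Cφ := (norm_nonneg _).trans (hφC 1)
  have hHc : Continuous fun g : (quasiSplit (↥(maximalRealSubfield L)) L (IsCMField.complexConj L) 2).Adelic => (borelHeight g : ℝ) := NNReal.continuous_coe.comp continuous_borelHeight
  refine continuous_const.mul ?_
  -- measurability in `k` for each `t` (tower), domination by the constant, pointwise continuity in `t`
  have hmW : Continuous fun q : (((standardMaximalCompactGL 2 L).comap (adelicVal (↥(maximalRealSubfield L)) L (IsCMField.complexConj L) 2 ((StdForm.antidiagonal 2).over L)) : Subgroup (quasiSplit (↥(maximalRealSubfield L)) L (IsCMField.complexConj L) 2).Adelic) × ℝ) × ↥(adelicUnipotent (↥(maximalRealSubfield L)) L (IsCMField.complexConj L) 2) => ((quasiSplit (↥(maximalRealSubfield L)) L (IsCMField.complexConj L) 2).toAdelic (weylLongU ((IsCMField.complexConj L : L ≃ₐ[↥(maximalRealSubfield L)] L) : L →+* L) (rfl : (StdForm.antidiagonal 2).over L = (StdForm.antidiagonal 2).over L))) * ((q.2 : (quasiSplit (↥(maximalRealSubfield L)) L (IsCMField.complexConj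 L) 2).Adelic) * (q.1.1 : (quasiSplit (↥(maximalRealSubfield L)) L (IsCMField.complexConj L) 2).Adelic)) :=
    continuous_const.mul ((continuous_subtype_val.comp continuous_snd).mul (continuous_subtype_val.comp (continuous_fst.comp continuous_fst)))
  have hR : Measurable fun q : (((standardMaximalCompactGL 2 L).comap (adelicVal (↥(maximalRealSubfield L)) L (IsCMField.complexConj L) 2 ((StdForm.antidiagonal 2).over L)) : Subgroup (quasiSplit (↥(maximalRealSubfield L)) L (IsCMField.complexConj L) 2).Adelic) × ℝ) × ↥(adelicUnipotent (↥(maximalRealSubfield L)) L (IsCMField.complexConj L) 2) => flatSectionU ψ ((σ₀ : ℂ) + (y q.1.2 : ℝ) * I) (((quasiSplit (↥(maximalRealSubfield L)) L (IsCMField.complexConj L) 2).toAdelic (weylLongU ((IsCMField.complexConj L : L ≃ₐ[↥(maximalRealSubfield L)] L) : L →+* L) (rfl : (StdForm.antidiagonal 2).over L = (StdForm.antidiagonal 2).over L))) * ((q.2 : (quasiSplit (↥(maximalRealSubfield L)) L (IsCMField.complexConj L) 2).Adelic) * (q.1.1 : (quasiSplit (↥(maximalRealSubfield L)) L (IsCMField.complexConj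 L) 2).Adelic))) := by
    simp only [flatSectionU_apply]
    exact (hψc.measurable.comp hmW.measurable).mul (((continuous_ofReal.comp hHc).measurable.comp hmW.measurable).pow
      ((continuous_const.add ((continuous_ofReal.comp (hy.comp (continuous_snd.comp continuous_fst))).mul continuous_const)).measurable))
  set Ic : ((standardMaximalCompactGL 2 L).comap (adelicVal (↥(maximalRealSubfield L)) L (IsCMField.complexConj L) 2 ((StdForm.antidiagonal 2).over L)) : Subgroup (quasiSplit (↥(maximalRealSubfield L)) L (IsCMField.complexConj L) 2).Adelic) × ℝ → ℂ := fun p => ∫ v : ↥(adelicUnipotent (↥(maximalRealSubfield L)) L (IsCMField.complexConj L) 2), flatSectionU ψ ((σ₀ : ℂ) + (y p.2) * I) (((quasiSplit (↥(maximalRealSubfield L)) L (IsCMField.complexConj L) 2).toAdelic (weylLongU ((IsCMField.complexConj L : L ≃ₐ[↥(maximalRealSubfield L)] L) : L →+* L) (rfl : (StdForm.antidiagonal 2).over L = (StdForm.antidiagonal 2).over L))) * ((v : (quasiSplit (↥(maximalRealSubfield L)) L (IsCMField.complexConj L) 2).Adelic) * (p.1 : (quasiSplit (↥(maximalRealSubfield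 L)) L (IsCMField.complexConj L) 2).Adelic))) ∂ν with hIcdef
  have hIcm : Measurable Ic := (hR.stronglyMeasurable.integral_prod_right' (ν := ν)).measurable
  have hF' : Measurable fun p : ((standardMaximalCompactGL 2 L).comap (adelicVal (↥(maximalRealSubfield L)) L (IsCMField.complexConj L) 2 ((StdForm.antidiagonal 2).over L)) : Subgroup (quasiSplit (↥(maximalRealSubfield L)) L (IsCMField.complexConj L) 2).Adelic) × ℝ => φ (p.1 : (quasiSplit (↥(maximalRealSubfield L)) L (IsCMField.complexConj L) 2).Adelic) * conj (Ic p) := (hφc.measurable.comp (measurable_subtype_coe.comp measurable_fst)).mul (continuous_conj.measurable.comp hIcm)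
  have hFm : ∀ t : ℝ, AEStronglyMeasurable (fun k : ((standardMaximalCompactGL 2 L).comap (adelicVal (↥(maximalRealSubfield L)) L (IsCMField.complexConj L) 2 ((StdForm.antidiagonal 2).over L)) : Subgroup (quasiSplit (↥(maximalRealSubfield L)) L (IsCMField.complexConj L) 2).Adelic) => φ (k : (quasiSplit (↥(maximalRealSubfield L)) L (IsCMField.complexConj L) 2).Adelic) * conj (∫ v : ↥(adelicUnipotent (↥(maximalRealSubfield L)) L (IsCMField.complexConj L) 2), flatSectionU ψ ((σ₀ : ℂ) + (y t) * I) (((quasiSplit (↥(maximalRealSubfield L)) L (IsCMField.complexConj L) 2).toAdelic (weylLongU ((IsCMField.complexConj L : L ≃ₐ[↥(maximalRealSubfield L)] L) : L →+* L) (rfl : (StdForm.antidiagonal 2).over L = (StdForm.antidiagonal 2).over L))) * ((v : (quasiSplit (↥(maximalRealSubfield L)) L (IsCMField.complexConj L) 2).Adelic) * (k : (quasiSplit (↥(maximalRealSubfield L)) L (IsCMField.complexConj L) 2).Adelic))) ∂ν)) μK := fun t =>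
    (hF'.comp (measurable_id.prodMk measurable_const)).aestronglyMeasurable
  have hIb : ∀ (t : ℝ) (k : ((standardMaximalCompactGL 2 L).comap (adelicVal (↥(maximalRealSubfield L)) L (IsCMField.complexConj L) 2 ((StdForm.antidiagonal 2).over L)) : Subgroup (quasiSplit (↥(maximalRealSubfield L)) L (IsCMField.complexConj L) 2).Adelic)), ‖∫ v : ↥(adelicUnipotent (↥(maximalRealSubfield L)) L (IsCMField.complexConj L) 2), flatSectionU ψ ((σ₀ : ℂ) + (y t) * I) (((quasiSplit (↥(maximalRealSubfield L)) L (IsCMField.complexConj L) 2).toAdelic (weylLongU ((IsCMField.complexConj L : L ≃ₐ[↥(maximalRealSubfield L)] L) : L →+* L) (rfl : (StdForm.antidiagonal 2).over L = (StdForm.antidiagonal 2).over L))) * ((v : (quasiSplit (↥(maximalRealSubfield L)) L (IsCMField.complexConj L) 2).Adelic) * (k : (quasiSplit (↥(maximalRealSubfield L)) L (IsCMField.complexConj L) 2).Adelic))) ∂ν‖ ≤ Cψ * (∫ v : ↥(adelicUnipotent (↥(maximalRealSubfield L)) L (IsCMField.complexConj L) 2), (borelHeight (((quasiSplit (↥(maximalRealSubfield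 L)) L (IsCMField.complexConj L) 2).toAdelic (weylLongU ((IsCMField.complexConj L : L ≃ₐ[↥(maximalRealSubfield L)] L) : L →+* L) (rfl : (StdForm.antidiagonal 2).over L = (StdForm.antidiagonal 2).over L))) * (v : (quasiSplit (↥(maximalRealSubfield L)) L (IsCMField.complexConj L) 2).Adelic)) : ℝ) ^ σ₀ ∂ν) := fun t k => by
    have h := norm_integral_flatSectionU_weylLongU_maximalCompact_le_cm_two L ν h𝓕N h𝓕c hψC (z := ((σ₀ : ℂ) + (y t) * I)) (by simpa using hσ₀) k
    simpa using h
  refine continuous_of_dominated hFm (fun t => ae_of_all _ fun k => ?_) (integrable_const (Cφ * (Cψ * (∫ v : ↥(adelicUnipotent (↥(maximalRealSubfield L)) L (IsCMField.complexConj L) 2), (borelHeight (((quasiSplit (↥(maximalRealSubfield L)) L (IsCMField.complexConj L) 2).toAdelic (weylLongU ((IsCMField.complexConj L : L ≃ₐ[↥(maximalRealSubfield L)] L) : L →+* L) (rfl : (StdForm.antidiagonal 2).over L = (StdForm.antidiagonal 2).over L))) * (v : (quasiSplit (↥(maximalRealSubfield L)) L (IsCMField.complexConj L) 2).Adelic))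 : ℝ) ^ σ₀ ∂ν)))) (ae_of_all _ fun k => ?_)
  · rw [norm_mul, Complex.norm_conj]
    exact mul_le_mul (hφC _) (hIb t k) (norm_nonneg _) hCφ
  · exact continuous_const.mul (continuous_conj.comp ((continuous_integral_flatSectionU_weylLongU_vertical_cm_two L ν h𝓕N h𝓕c hψc hψC hσ₀ (k : (quasiSplit (↥(maximalRealSubfield L)) L (IsCMField.complexConj L) 2).Adelic)).comp hy))

end Summit.HodgeConjecture.HodgeConjecture.Cruxes.H413.K2E1ChiSectionPairingLineRegularityCMTwo

end
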